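import Summits.QuantumFields.YangMills.Theorems.UnitScaleTiltProp7BCHPieceRows
import Summits.QuantumFields.YangMills.Theorems.UnitScaleTiltProp7NonlinPartPackaged
import HarnessLib

/-!
# Prop 7, route-R E′, (E1-c) brick F4g — THE `P₃` (BCH) PIECE UNDER `ℓ²D*_W`, PACKAGED: `ℓ²‖D*[P₃u − P₃u′](x)‖ ≤ 2|ι|·ℓ²·β·(24K·mᵘ_d + 8δᵘ_d)`

Route `UnitScaleTilt`, crux K1 child «MinimiserStabilityRegPr» (`stmt-QuantumFields-19200`), cell ym3-torus, width seat px15 (gen 2); pen «px15 g2: (E1-c) GO-LOCATE» (★p1 g15,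
2026-08-28T20:45:05Z), LOCATE `LOCATE-E1C-DIVLIPSCHITZ-px15g2.md` §6 (F4: `P₃` is CRUDE).  THEOREMS ONLY (0 `def`, 0 `sorry`); `--supports stmt-QuantumFields-19200`, count-neutral.
YM₃ on T³ is a ladder rung (R3), not the Clay problem; nothing here claims the stub, the crux, d = 4 or the mass gap.

WHAT (F1's abstract `(T,U)` letters over `M_N(ℂ)`, norm-preserving transports).  At the bond `(y,μ)`: `u = u(y)` unitary (`‖u‖ ≤ 1`, `uu* = 1`), data `B = log E(μ,y)` (`‖B‖ ≤ β ≤ 1∕40`),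
`Q := u·(R(U μ y)u(T μ y))* = 1 + u·(D_μu(y))*`, and `P₃u(μ,y) := log(e^{uBu*}·e^{log Q}) − uBu* − log Q` (F4f ⧗p674854's third piece).  With `‖D_μu‖ ≤ δᵘ`, `‖D_μu′‖ ≤ δᵘ′`,
`K := δᵘ + δᵘ′ ≤ 1∕80`, `‖u − u′‖ ≤ mᵘ_d`, `‖D_μu − D_μu′‖ ≤ δᵘ_d`:
* `norm_gaugeLog_le` (`‖log Q‖ ≤ 2K`), `norm_gaugeLog_sub_le` (`‖log Q − log Q′‖ ≤ 2(mᵘ_d·K + δᵘ_d)`), ★ `norm_bchPiece_bond_sub_le` (`‖P₃u(b) − P₃u′(b)‖ ≤ β(24K·mᵘ_d + 8δᵘ_d)`),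
* ★★★ `norm_divB_bchPiece_le` (crude rule ✓p673053 `norm_divB_le_sum'`): `ℓ²‖D*[P₃u − P₃u′](x)‖ ≤ 2|ι|·ℓ²·β·(24K·mᵘ_d + 8δᵘ_d)`.
In the currency: `ℓβ ≤ ‖D‴‖_Y`, `ℓK ≤ e^{R₀}(pψ + pψ′)`, `mᵘ_d ≤ e^{R₀}p(ψ−ψ′)`, `ℓδᵘ_d ≤ e^{R₀}(1 + 2pψ′)p(ψ−ψ′)` (F4d(iii) ✓p674383).  HONEST SCOPE.  Assembly ([folklore]).

References: T. Bałaban, CMP 98 (1985) 17–51 [Balaban1985Averaging] ((19)–(21) p.21, (26) p.22); CMP 99 (1985) 389–434 [Balaban1985BackgroundPropagators] ((3.8) p.392).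
-/

set_option autoImplicit false

noncomputable section

open scoped BigOperators Matrix.Norms.L2Operator Matrix
open NormedSpace

namespace Summit.QuantumFields.YangMills.Theorems.Prop7BCHPiecePackaged

open Literature.MathematicalPhysics.QuantumFieldTheory.Balaban1983to89
open Finset
open MatrixLog (mlog norm_mlog_le_two_mul)
open B9Eq39Adjoint (R covD covDstar divB)
open Summit.QuantumFields.YangMills.Theorems.Prop7BCHPieceRows (norm_bchPiece_sub_le norm_mlog_sub_mlog_le gaugeProduct_sub_one norm_gaugeProduct_sub_le)
open Summit.QuantumFields.YangMills.Theorems.Prop7NonlinPartPackaged (norm_divB_le_sum')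

variable {n : Type*} [Fintype n] [DecidableEq n] [Nonempty n]
variable {S : Type*} {ι : Type*} (T : ι → Equiv.Perm S) (U : ι → S → (Matrix n n ℂ)ˣ)

omit [Nonempty n] in
/-- `R(U μ y)u(T μ y) = u(y) + D_μu(y)`. (bookkeeping) [folklore] -/
theorem transport_eq_add_covD (μ : ι) (u : S → Matrix n n ℂ) (y : S) : R (U μ y) (u (T μ y)) = u y + covD T U μ u y := by
  simp only [covD, add_sub_cancel]

omit [Nonempty n] in
/-- SIZE of the gauge log: `‖log(u·(Ru₊)*)‖ ≤ 2‖D_μu(y)‖` when `uu* = 1`, `‖u‖ ≤ 1`, `‖D_μu‖ ≤ ½`. [cite: Balaban1985Averaging, (21) p.21] -/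
theorem norm_gaugeLog_le (μ : ι) {u : S → Matrix n n ℂ} (hu1 : ∀ y, ‖u y‖ ≤ 1) (huu : ∀ y, u y * star (u y) = 1) (y : S)
    {K : ℝ} (hD : ‖covD T U μ u y‖ ≤ K) (hK : K ≤ 1 / 2) :
    ‖u y * star (R (U μ y) (u (T μ y))) - 1‖ ≤ K ∧ ‖mlog (u y * star (R (U μ y) (u (T μ y))))‖ ≤ 2 * K := by
  rw [transport_eq_add_covD, gaugeProduct_sub_one (huu y)]
  have h1 : ‖u y * star (covD T U μ u y)‖ ≤ K := ((norm_gaugeProduct_sub_le (hu1 y) (hu1 y) _ (covD T U μ u y)).1).trans hD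
  refine ⟨h1, ?_⟩
  have h2 : ‖u y * star (u y + covD T U μ u y) - 1‖ ≤ 1 / 2 := by rw [gaugeProduct_sub_one (huu y)]; exact h1.trans hK
  calc _ ≤ 2 * ‖u y * star (u y + covD T U μ u y) - 1‖ := norm_mlog_le_two_mul h2
    _ ≤ 2 * K := by rw [gaugeProduct_sub_one (huu y)]; linarith

omit [Nonempty n] in
/-- LIPSCHITZ row of the gauge log: `‖log Q − log Q′‖ ≤ 2(‖u−u′‖·K + ‖D_μu − D_μu′‖)` for `K ≤ ½` bounding `‖D_μu‖, ‖D_μu′‖`. [cite: Balaban1985Averaging, (26) p.22] -/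
theorem norm_gaugeLog_sub_le (μ : ι) {u u' : S → Matrix n n ℂ} (hu1 : ∀ y, ‖u y‖ ≤ 1) (hu1' : ∀ y, ‖u' y‖ ≤ 1)
    (huu : ∀ y, u y * star (u y) = 1) (huu' : ∀ y, u' y * star (u' y) = 1) (y : S)
    {K : ℝ} (hD : ‖covD T U μ u y‖ ≤ K) (hD' : ‖covD T U μ u' y‖ ≤ K) (hK : K ≤ 1 / 2) :
    ‖mlog (u y * star (R (U μ y) (u (T μ y)))) - mlog (u' y * star (R (U μ y) (u' (T μ y))))‖
      ≤ 2 * (‖u y - u' y‖ * K + ‖covD T U μ u y - covD T U μ u' y‖) := by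
  have hQ := (norm_gaugeLog_le T U μ hu1 huu y hD hK).1
  have hQ' := (norm_gaugeLog_le T U μ hu1' huu' y hD' hK).1
  have h := norm_mlog_sub_mlog_le (hK.trans_lt (by norm_num)) hQ hQ'
  refine h.trans ?_
  rw [transport_eq_add_covD, transport_eq_add_covD]
  have hdiff : ‖u y * star (u y + covD T U μ u y) - u' y * star (u' y + covD T U μ u' y)‖
      ≤ ‖u y - u' y‖ * K + ‖covD T U μ u y - covD T U μ u' y‖ := by
    have e : u y * star (u y + covD T U μ u y) - u' y * star (u' y + covD T U μ u' y)
        = u y * star (covD T U μ u y) - u' y * star (covD T U μ u' y) := by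
      rw [← sub_sub_sub_cancel_right _ _ (1 : Matrix n n ℂ), gaugeProduct_sub_one (huu y), gaugeProduct_sub_one (huu' y)]
    rw [e]
    refine ((norm_gaugeProduct_sub_le (hu1 y) (hu1' y) _ _).2).trans ?_
    exact add_le_add (mul_le_mul_of_nonneg_left hD (norm_nonneg _)) le_rfl
  have hK1 : 0 < 1 - K := by linarith
  rw [div_le_iff₀ hK1]
  have h0 : 0 ≤ ‖u y - u' y‖ * K + ‖covD T U μ u y - covD T U μ u' y‖ := by
    have : 0 ≤ K := (norm_nonneg _).trans hD
    positivity
  nlinarith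

/-- ★ BOND ROW of `P₃`: `‖P₃u(μ,y) − P₃u′(μ,y)‖ ≤ β·(24K·mᵘ_d + 8δᵘ_d)`. [cite: Balaban1985Averaging, (19)-(21) p.21] -/
theorem norm_bchPiece_bond_sub_le {u u' : S → Matrix n n ℂ} (hu1 : ∀ y, ‖u y‖ ≤ 1) (hu1' : ∀ y, ‖u' y‖ ≤ 1)
    (huu : ∀ y, u y * star (u y) = 1) (huu' : ∀ y, u' y * star (u' y) = 1)
    (B : ι → S → Matrix n n ℂ) {β K mud δud : ℝ} (hβ : ∀ μ y, ‖B μ y‖ ≤ β) (hβ40 : β ≤ 1 / 40)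
    (hD : ∀ μ y, ‖covD T U μ u y‖ ≤ K) (hD' : ∀ μ y, ‖covD T U μ u' y‖ ≤ K) (hK : K ≤ 1 / 80)
    (hmud : ∀ y, ‖u y - u' y‖ ≤ mud) (hδud : ∀ μ y, ‖covD T U μ u y - covD T U μ u' y‖ ≤ δud) (μ : ι) (y : S) :
    ‖(mlog (exp (u y * B μ y * star (u y)) * exp (mlog (u y * star (R (U μ y) (u (T μ y))))))
          - u y * B μ y * star (u y) - mlog (u y * star (R (U μ y) (u (T μ y)))))
        - (mlog (exp (u' y * B μ y * star (u' y)) * exp (mlog (u' y * star (R (U μ y) (u' (T μ y))))))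
          - u' y * B μ y * star (u' y) - mlog (u' y * star (R (U μ y) (u' (T μ y)))))‖
      ≤ β * (24 * K * mud + 8 * δud) := by
  have hK2 : K ≤ 1 / 2 := hK.trans (by norm_num)
  have hY := (norm_gaugeLog_le T U μ hu1 huu y (hD μ y) hK2).2
  have hY' := (norm_gaugeLog_le T U μ hu1' huu' y (hD' μ y) hK2).2
  have h := norm_bchPiece_sub_le (hu1 y) (hu1' y) (hβ μ y) hβ40 hY hY' (by linarith)
  have hL := norm_gaugeLog_sub_le T U μ hu1 hu1' huu huu' y (hD μ y) (hD' μ y) hK2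
  refine h.trans ?_
  have hβ0 : 0 ≤ β := (norm_nonneg _).trans (hβ μ y)
  have hK0 : 0 ≤ K := (norm_nonneg _).trans (hD μ y)
  have h1 : 8 * (2 * K) * β * ‖u y - u' y‖ ≤ 16 * K * β * mud := by
    have := mul_le_mul_of_nonneg_left (hmud y) (by positivity : 0 ≤ 16 * K * β); linarith
  have h2 : 4 * β * ‖mlog (u y * star (R (U μ y) (u (T μ y)))) - mlog (u' y * star (R (U μ y) (u' (T μ y))))‖
      ≤ 4 * β * (2 * (mud * K + δud)) := by
    refine mul_le_mul_of_nonneg_left (hL.trans ?_) (by positivity)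
    have := mul_le_mul_of_nonneg_right (hmud y) hK0
    linarith [hδud μ y]
  nlinarith [h1, h2]

variable [Fintype ι]

/-- ★★★ **THE `P₃` PIECE UNDER `ℓ²D*`**: `ℓ²‖D*[P₃u − P₃u′](x)‖ ≤ 2|ι|·ℓ²·β·(24K·mᵘ_d + 8δᵘ_d)`. [cite: Balaban1985BackgroundPropagators, (3.8) p.392] [cite: Balaban1985Averaging, (19)-(21) p.21] -/
theorem norm_divB_bchPiece_le (hRn : ∀ μ x (M : Matrix n n ℂ), ‖R (U μ x)⁻¹ M‖ = ‖M‖)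
    {u u' : S → Matrix n n ℂ} (hu1 : ∀ y, ‖u y‖ ≤ 1) (hu1' : ∀ y, ‖u' y‖ ≤ 1)
    (huu : ∀ y, u y * star (u y) = 1) (huu' : ∀ y, u' y * star (u' y) = 1)
    (B : ι → S → Matrix n n ℂ) {β K mud δud : ℝ} (hβ : ∀ μ y, ‖B μ y‖ ≤ β) (hβ40 : β ≤ 1 / 40)
    (hD : ∀ μ y, ‖covD T U μ u y‖ ≤ K) (hD' : ∀ μ y, ‖covD T U μ u' y‖ ≤ K) (hK : K ≤ 1 / 80)
    (hmud : ∀ y, ‖u y - u' y‖ ≤ mud) (hδud : ∀ μ y, ‖covD T U μ u y - covD T U μ u' y‖ ≤ δud) (ℓ : ℕ) (x : S) :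
    (ℓ : ℝ) ^ 2 * ‖divB T U (fun μ y =>
        (mlog (exp (u y * B μ y * star (u y)) * exp (mlog (u y * star (R (U μ y) (u (T μ y))))))
            - u y * B μ y * star (u y) - mlog (u y * star (R (U μ y) (u (T μ y)))))
          - (mlog (exp (u' y * B μ y * star (u' y)) * exp (mlog (u' y * star (R (U μ y) (u' (T μ y))))))
            - u' y * B μ y * star (u' y) - mlog (u' y * star (R (U μ y) (u' (T μ y)))))) x‖
      ≤ 2 * (Fintype.card ι : ℝ) * (ℓ : ℝ) ^ 2 * (β * (24 * K * mud + 8 * δud)) := by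
  set Bnd := β * (24 * K * mud + 8 * δud) with hBnd
  have hb : ∀ μ y, ‖(mlog (exp (u y * B μ y * star (u y)) * exp (mlog (u y * star (R (U μ y) (u (T μ y))))))
          - u y * B μ y * star (u y) - mlog (u y * star (R (U μ y) (u (T μ y)))))
        - (mlog (exp (u' y * B μ y * star (u' y)) * exp (mlog (u' y * star (R (U μ y) (u' (T μ y))))))
          - u' y * B μ y * star (u' y) - mlog (u' y * star (R (U μ y) (u' (T μ y)))))‖ ≤ Bnd :=
    fun μ y => norm_bchPiece_bond_sub_le T U hu1 hu1' huu huu' B hβ hβ40 hD hD' hK hmud hδud μ y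
  have hcrude := norm_divB_le_sum' T U hRn (fun μ y =>
        (mlog (exp (u y * B μ y * star (u y)) * exp (mlog (u y * star (R (U μ y) (u (T μ y))))))
            - u y * B μ y * star (u y) - mlog (u y * star (R (U μ y) (u (T μ y)))))
          - (mlog (exp (u' y * B μ y * star (u' y)) * exp (mlog (u' y * star (R (U μ y) (u' (T μ y))))))
            - u' y * B μ y * star (u' y) - mlog (u' y * star (R (U μ y) (u' (T μ y)))))) x
  have hsum := Finset.sum_le_sum (s := Finset.univ) fun μ (_ : μ ∈ Finset.univ) => add_le_add (hb μ ((T μ).symm x)) (hb μ x)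
  rw [Finset.sum_const, Finset.card_univ, nsmul_eq_mul] at hsum
  have hℓ2 : 0 ≤ (ℓ : ℝ) ^ 2 := sq_nonneg _
  calc _ ≤ (ℓ : ℝ) ^ 2 * (Fintype.card ι * (Bnd + Bnd)) := mul_le_mul_of_nonneg_left (hcrude.trans hsum) hℓ2
    _ = 2 * (Fintype.card ι : ℝ) * (ℓ : ℝ) ^ 2 * Bnd := by ring

end Summit.QuantumFields.YangMills.Theorems.Prop7BCHPiecePackaged

end
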